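import Literature.AlgebraicGeometry.HodgeTheory.ChernCharacterBettiLaws
import Summits.HodgeConjecture.HodgeConjecture.Theses.EightfoldTwistedSheafSeeds
import HarnessLib

/-!
# `ChernCharacterOnBetti` (stmt-HodgeConjecture-19780): the crux and two stubs of its line, in the tree's (now importable) vocabulary

Route `EightfoldBlochSeeds` (decl of record `Theses.EightfoldTwistedSheafSeeds.ChernCharacterOnBetti =
Ring2.SemiregularRepresentatives.ChernCharacterOnBetti = Nonempty ChernCharacterBetti`, shared with `TensorMonadSeeds` /
`FirstOrderSemiregularSeeds` / `VHCAbelianSchemesRoad`), item `stmt-HodgeConjecture-19780`, helper (`--supports`). HONEST FRAMING: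
nothing here proves 19780 / 18880 / 18882 / 18883 / H2 / HC_AV / HC_CM / HC; the crux is REDUCED, not closed; no definition, no
named fact.

The crux line `Cruxes/ChernCharacterOnBetti/Lines/grothendieck_axiomatic.lean` declares its vocabulary (`ChernDatum`,
`IsTopologicalChernCharacter`, `NonDegenerate`, `FirstChernDatum`, `IsFirstChernClass`, `FirstChernNonDegenerate`) LOCALLY, so no
`Theorems` file could state its stubs by name (CONVENTIONS §2). That vocabulary now lives in `Literature/` VERBATIM
(`HodgeTheory/ChernCharacterBettiLaws`, p835237: `ChernDatum`, `ChernDatum.IsTopological`, `ChernDatum.NonDegenerate`,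
`FirstChernDatum`, `FirstChernDatum.IsFirstChernClass`, `FirstChernDatum.NonDegenerate`); once the skeleton replaces its local
declarations by `abbrev`s to these (a crux-write edit; checked here against a patched copy, `lean check` rc 0, sorries 3), the
following are its stubs BY NAME:

* `stub_algebraicity_holds'` — **`stub_algebraicity` verbatim**: `∀ ch : ChernDatum, ch.IsTopological → … → ch X E i ∈ algebraicClasses X i`
  (`ChernDatum.IsTopological.ch_mem_algebraicClasses`, i.e. `ch_mem_algebraicClasses_of_laws`, p834451);
* `stub_span_of_spanForOne` — **`stub_span` verbatim, GRANTED the span law in positive degrees for ONE lawful non-degenerate datum**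
  (LEMMA U for raw data, p835116, through `ChernDatum.IsTopological.algebraicClasses_le_span_of_spanForOne`);
* `chernCharacterOnBetti_iff_exists_isTopological_span` — **the crux itself is EQUIVALENT to the existence of ONE lawful datum with the
  span law in positive degrees** (`nonempty_chernCharacterBetti_iff`: algebraicity and the degree-`0` span law are automatic), and the
  implication `chernCharacterOnBetti_of_exists_isTopological_span` a construction seat would use to close 19780.

[cite: Grothendieck1958, Thm. 1 and §2] [cite: Fulton1998, §15.1, Prop. 19.1.2 and Example 15.2.16 (b)] [cite: VoisinHodgeI2002, Thm. 11.23 and Thm. 11.32]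
-/

noncomputable section

-- single-problem summit (Problem = Summit): the mandated namespace repeats `HodgeConjecture`.
set_option linter.dupNamespace false

open CategoryTheory AlgebraicGeometry
open Literature.AlgebraicGeometry.Motives Literature.AlgebraicGeometry.HodgeTheory
open Literature.AlgebraicTopology.SingularHomology

namespace Summit.HodgeConjecture.HodgeConjecture.Theorems

/-- **`stub_algebraicity` by name**: every datum with the nine topological laws is algebraic on smooth projective complex varieties
(`ChernDatum.IsTopological.ch_mem_algebraicClasses`; only four laws are used). [cite: Fulton1998, Prop. 19.1.2 and Cor. 19.2 (b)]
[cite: VoisinHodgeI2002, Thm. 11.32] -/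
theorem stub_algebraicity_holds' :
    ∀ ch : ChernDatum, ch.IsTopological →
      ∀ {n : ℕ} {X : SchemeOver ℂ}, IsSmoothProjective n X →
        ∀ (E : X.left.Modules), IsVectorBundle E → ∀ i : ℕ, ch X E i ∈ algebraicClasses X i :=
  fun _ h _ _ hX E hE i ↦ h.ch_mem_algebraicClasses hX E hE i

/-- **`stub_span` by name, granted the span law for ONE lawful non-degenerate datum** (`ch₀`, in positive degrees, on smooth
projective varieties): Grothendieck uniqueness transports the span law to every lawful non-degenerate datum, and degree `0` is
automatic. [cite: Grothendieck1958, Thm. 1 (uniqueness)] [cite: Fulton1998, Example 15.2.16 (b)] [cite: Deligne2000, §2 Remark (ii)] -/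
theorem stub_span_of_spanForOne
    (hex : ∃ ch₀ : ChernDatum, ch₀.IsTopological ∧ ch₀.NonDegenerate ∧
      ∀ {n : ℕ} {X : SchemeOver ℂ}, IsSmoothProjective n X → ∀ {p : ℕ}, 0 < p →
        algebraicClasses X p ≤ Submodule.span ℂ {c | ∃ E : X.left.Modules, IsVectorBundle E ∧ ch₀ X E p = c}) :
    ∀ ch : ChernDatum, ch.IsTopological → ch.NonDegenerate →
      ∀ {n : ℕ} {X : SchemeOver ℂ}, IsSmoothProjective n X → ∀ p : ℕ,
        algebraicClasses X p ≤ Submodule.span ℂ {c | ∃ E : X.left.Modules, IsVectorBundle E ∧ ch X E p = c} := by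
  obtain ⟨ch₀, h₀, hnd₀, hspan₀⟩ := hex
  exact fun ch h hnd _ _ hX p ↦ h₀.algebraicClasses_le_span_of_spanForOne hnd₀ hspan₀ h hnd hX p

/-- **The crux `ChernCharacterOnBetti` ⟺ ONE lawful datum with the span law in positive degrees exists** (the cycle law of
algebraicity, Fulton Prop. 19.1.2, and the degree-`0` span law are consequences of the topological laws). The construction item is
therefore: BUILD a `ch : ChernDatum` with the nine topological laws (Grothendieck 1958 Thm. 1, existence) AND prove Fulton's span
property `Nᵖ H²ᵖ ⊆ ℂ · {ch_p(E)}` for it (`p ≥ 1`; Example 15.2.16 (b): resolutions + Riemann–Roch without denominators).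
[cite: Grothendieck1958, Thm. 1] [cite: Fulton1998, §15.1, Prop. 19.1.2 and Example 15.2.16 (b)] -/
theorem chernCharacterOnBetti_iff_exists_isTopological_span :
    Summit.HodgeConjecture.HodgeConjecture.Theses.EightfoldTwistedSheafSeeds.ChernCharacterOnBetti ↔
      ∃ ch : ChernDatum, ch.IsTopological ∧
        ∀ {n : ℕ} {X : SchemeOver ℂ}, IsSmoothProjective n X → ∀ {p : ℕ}, 0 < p →
          algebraicClasses X p ≤ Submodule.span ℂ {c | ∃ E : X.left.Modules, IsVectorBundle E ∧ ch X E p = c} :=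
  nonempty_chernCharacterBetti_iff

/-- **How a construction seat closes 19780**: exhibit ONE `ch : ChernDatum` with the nine topological laws and the span law in positive
degrees on smooth projective varieties. [cite: Grothendieck1958, Thm. 1] [cite: Fulton1998, Example 15.2.16 (b)] -/
theorem chernCharacterOnBetti_of_exists_isTopological_span
    (hex : ∃ ch : ChernDatum, ch.IsTopological ∧
      ∀ {n : ℕ} {X : SchemeOver ℂ}, IsSmoothProjective n X → ∀ {p : ℕ}, 0 < p →
        algebraicClasses X p ≤ Submodule.span ℂ {c | ∃ E : X.left.Modules, IsVectorBundle E ∧ ch X E p = c}) :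
    Summit.HodgeConjecture.HodgeConjecture.Theses.EightfoldTwistedSheafSeeds.ChernCharacterOnBetti :=
  chernCharacterOnBetti_iff_exists_isTopological_span.2 hex

/-- The same for the decl of record `Ring2.SemiregularRepresentatives.ChernCharacterOnBetti` (to which every route's
`ChernCharacterOnBetti` unfolds). [cite: Grothendieck1958, Thm. 1] [cite: Fulton1998, Example 15.2.16 (b)] -/
theorem ring2_chernCharacterOnBetti_of_exists_isTopological_span
    (hex : ∃ ch : ChernDatum, ch.IsTopological ∧
      ∀ {n : ℕ} {X : SchemeOver ℂ}, IsSmoothProjective n X → ∀ {p : ℕ}, 0 < p →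
        algebraicClasses X p ≤ Submodule.span ℂ {c | ∃ E : X.left.Modules, IsVectorBundle E ∧ ch X E p = c}) :
    Summit.HodgeConjecture.HodgeConjecture.Ring2.SemiregularRepresentatives.ChernCharacterOnBetti :=
  nonempty_chernCharacterBetti_iff.2 hex

end Summit.HodgeConjecture.HodgeConjecture.Theorems

end
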